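import Summits.NavierStokesRegularity.NavierStokesRegularity.Theses.SymmetryModuliCount

/-!
# Sketch — crux-ideate stmt-NavierStokesRegularity-4052 (ForcedSymmetry), ideator 3, round 1

First lemmas of the three crux idea cards, stated over existing declarations
(`Literature.Analysis.FluidPDE.*`, the route decl
`Summit.NavierStokesRegularity.NavierStokesRegularity.Theses.SymmetryModuliCount.ForcedSymmetry`).
Nothing here is proved except the pure-logic shape `crux_of_axis_pinning`.
-/

open Literature.Analysis.FluidPDE

set_option linter.dupNamespace false

noncomputable section

namespace Summit.NavierStokesRegularity.NavierStokesRegularity.Cruxes.ForcedSymmetry.Ideator3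

/-- `ℝ³`. -/
abbrev E3 := EuclideanSpace ℝ (Fin 3)

/-- Membership in the route's class `A_C`: smooth on `t<0`, divergence free, KNSS-mild
(Oseen-kernel integral identity), temporal Type-I bound `‖u(t,x)‖ ≤ C/√(-t)`. Verbatim the
hypothesis block of `SymmetryModuliCount.ForcedSymmetry`. -/
def InClass (C : ℝ) (u : ℝ → E3 → E3) : Prop :=
  ContDiffOn ℝ (⊤ : ℕ∞) (Function.uncurry u) (Set.Iio 0 ×ˢ Set.univ) ∧
  (∀ t < 0, VectorCalculus.IsDivFree (u t)) ∧
  (∀ s t : ℝ, s < t → t < 0 → ∀ x, u t x = heatFlow (u s) (t - s) x -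
      ∫ τ in Set.Ioo s t, ∫ y, oseenKernel (t - τ) (x - y) (u τ y) (u τ y)) ∧
  HasTypeITimeDecay C u

/-- The infinitesimal generator `L_ξ v` of `ξ = (a, σ, A) ∈ sim(3)` acting on a time-dependent
field, exactly as in the crux: `∇v·(a + σx + Ax) + σ v + 2σt ∂_t v − A v`. -/
def jacobi (a : E3) (σ : ℝ) (A : E3 →L[ℝ] E3) (v : ℝ → E3 → E3) (t : ℝ) (x : E3) : E3 :=
  fderiv ℝ (v t) x (a + σ • x + A x) + σ • v t x + (2 * σ * t) • timeDeriv v t x - A (v t x)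

/-- Backward time shift `T_h u (t, x) = u (t - h, x)` — the eighth, non-invertible similarity. -/
def timeShift (h : ℝ) (u : ℝ → E3 → E3) : ℝ → E3 → E3 := fun t x => u (t - h) x

/-! ## Card 1 — backward-shift self-improvement -/

/-- (1a) `A_C` is invariant under backward time shifts `h ≥ 0` (the Type-I weight strictly
improves: `C/√(h - t) ≤ C/√(-t)`; the Oseen identity is translation invariant in time). -/
def TimeShiftInvariant : Prop :=
  ∀ (C h : ℝ) (u : ℝ → E3 → E3), 0 ≤ h → InClass C u → InClass C (timeShift h u)

/-- (1b) Conjugation identity: `L_ξ (T_h w) (t,x) = (L_ξ w)(t-h,x) + 2σh ∂_t w (t-h,x)` — the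
scaling component of `ξ` picks up a time-translation Jacobi field. (Pure calculus:
`timeDeriv (T_h w) t x = timeDeriv w (t-h) x`, `deriv_comp_sub_const`.) -/
def JacobiConjugation : Prop :=
  ∀ (w : ℝ → E3 → E3) (h : ℝ) (a : E3) (σ : ℝ) (A : E3 →L[ℝ] E3) (t : ℝ) (x : E3),
    jacobi a σ A (timeShift h w) t x = jacobi a σ A w (t - h) x + (2 * σ * h) • timeDeriv w (t - h) x

/-- (1c) VERTEX LEMMA. If `w` is `C¹` on `t < 0` and is annihilated, on `t < -h` (`h > 0`), by the
generator of spiral scalings about the INTERIOR space–time vertex `t = -h` (that is,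
`L_ξ w + 2σh ∂_t w = 0` with `σ ≠ 0`), then `w ≡ 0` on `t < -h`: the characteristics of the
space–time vector field `2σ(t+h)∂_t + (a+σx+Ax)·∇` run into the vertex, along them `‖w‖` is
multiplied by `e^{-σθ} → ∞`, contradicting continuity of `w` at the vertex. -/
def VertexLemma : Prop :=
  ∀ (w : ℝ → E3 → E3) (h σ : ℝ) (a : E3) (A : E3 →L[ℝ] E3), 0 < h → σ ≠ 0 →
    (∀ x, inner ℝ (A x) x = 0) →
    ContDiffOn ℝ 1 (Function.uncurry w) (Set.Iio 0 ×ˢ Set.univ) →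
    (∀ t < -h, ∀ x, jacobi a σ A w t x + (2 * σ * h) • timeDeriv w t x = 0) →
    ∀ t < -h, ∀ x, w t x = 0

/-- Forced EUCLIDEAN symmetry: every element of `A_C` is annihilated by a nonzero Killing field
`x ↦ a + Ax` (translation, rotation or screw): `∇u·(a + Ax) − A u = 0` on every slice. -/
def ForcedIsometry : Prop :=
  ∀ (C : ℝ) (u : ℝ → E3 → E3), InClass C u →
    ∃ (a : E3) (A : E3 →L[ℝ] E3), (∀ x, inner ℝ (A x) x = 0) ∧ ¬ (a = 0 ∧ A = 0) ∧
      ∀ t < 0, ∀ x, fderiv ℝ (u t) x (a + A x) - A (u t x) = 0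

/-- (1d) SELF-IMPROVEMENT (the card's first theorem): the crux is equivalent to forced Euclidean
symmetry. `←` is trivial (`σ = 0`); `→` applies the crux to `T_h u ∈ A_C` for `h ↓ 0`, kills the
case `σ_h ≠ 0` by the vertex lemma + mild uniqueness (then `u ≡ 0`), and passes to the limit of
the normalised isometric generators `(a_h, A_h)` (compact unit sphere of `e(3)`). -/
def SelfImprovement : Prop :=
  Summit.NavierStokesRegularity.NavierStokesRegularity.Theses.SymmetryModuliCount.ForcedSymmetry
    ↔ ForcedIsometry

/-- (1e) SLICE RIGIDITY: an isometric symmetry of ONE time slice is a symmetry of the whole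
ancient solution (forward uniqueness of bounded mild solutions + backward uniqueness through the
vorticity equation); so the crux is a statement about a single vector field `u(t₀,·)`. -/
def SliceRigidity : Prop :=
  ∀ (C : ℝ) (u : ℝ → E3 → E3), InClass C u → ∀ (a : E3) (A : E3 →L[ℝ] E3) (t₀ : ℝ), t₀ < 0 →
    (∀ x, inner ℝ (A x) x = 0) → (∀ x, fderiv ℝ (u t₀) x (a + A x) - A (u t₀ x) = 0) →
    ∀ t < 0, ∀ x, fderiv ℝ (u t) x (a + A x) - A (u t x) = 0

/-! ## Card 2 — homogeneous statistics extinction ⇒ uniform large-scale sparseness -/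

/-- (2a) UNIFORM SPARSENESS (first Lean-stateable corollary of "the only translation-invariant law
on `A_C` is `δ₀`"): energy in balls much larger than the parabolic scale is sub-extensive,
uniformly over the class: `(-t) ⨍_{B_R(a)} ‖u(t)‖² → 0` as `R/√(-t) → ∞`. -/
def UniformSparseness : Prop :=
  ∀ (C ε : ℝ), 0 < ε → ∃ M : ℝ, 0 < M ∧ ∀ (u : ℝ → E3 → E3), InClass C u →
    ∀ t < 0, ∀ (a : E3) (R : ℝ), M * Real.sqrt (-t) ≤ R →
      (-t) * ∫ x in Metric.ball a R, ‖u t x‖ ^ 2 ≤ ε * R ^ 3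

/-- (2b) LIMINF GAP (elementary companion, small-data forward theory from `t = -∞`): a nonzero
element keeps Type-I amplitude `≥ ε₀` at all sufficiently early times. -/
def LiminfGap : Prop :=
  ∃ ε₀ : ℝ, 0 < ε₀ ∧ ∀ (C : ℝ) (u : ℝ → E3 → E3), InClass C u →
    (¬ ∀ t < 0, ∀ x, u t x = 0) → ∃ T : ℝ, T < 0 ∧ ∀ t ≤ T, ∃ x, ε₀ ≤ Real.sqrt (-t) * ‖u t x‖

/-! ## Card 3 — Albritton–Barker axis pinning (transfer line) -/

/-- (3a) BRIDGE between Type-I notions: a nonzero temporally-Type-I element yields a nonzero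
element with SPACE–TIME Type-I decay `‖v(t,x)‖ ≤ C'/(‖x‖ + √(-t))` (Albritton–Barker notion (a)).
Open; vacuous once the route is re-based on the A–B class. -/
def Bridge : Prop :=
  (∃ (C : ℝ) (u : ℝ → E3 → E3), InClass C u ∧ ¬ ∀ t < 0, ∀ x, u t x = 0) →
    ∃ (C : ℝ) (v : ℝ → E3 → E3), InClass C v ∧ HasTypeIDecay C v ∧ ¬ ∀ t < 0, ∀ x, v t x = 0

/-- (3b) AXIS PINNING — the hard core with the smallest possible target: in the decaying class
every element is either zero or invariant under a nonzero ROTATIONAL Killing field (`A ≠ 0`;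
translations and pure screws are incompatible with the decay, scalings are dead by Card 1). -/
def ForcedAxisymmetryDecaying : Prop :=
  ∀ (C : ℝ) (u : ℝ → E3 → E3), InClass C u → HasTypeIDecay C u →
    (∀ t < 0, ∀ x, u t x = 0) ∨
    ∃ (a : E3) (A : E3 →L[ℝ] E3), A ≠ 0 ∧ (∀ x, inner ℝ (A x) x = 0) ∧
      ∀ t < 0, ∀ x, fderiv ℝ (u t) x (a + A x) - A (u t x) = 0

/-- (3c) KNOWN LEAF: a decaying Type-I ancient mild solution with a rotational/screw symmetry is
zero (screw with pitch ≠ 0: unbounded orbits + decay; pitch 0 = axisymmetric: Seregin–Šverák 2009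
Prop 3.7/Thm 3.1 + KNSS 2009 Thm 5.3, in-tree facts). -/
def KnownAxisLeaf : Prop :=
  ∀ (C : ℝ) (u : ℝ → E3 → E3), InClass C u → HasTypeIDecay C u →
    ∀ (a : E3) (A : E3 →L[ℝ] E3), A ≠ 0 → (∀ x, inner ℝ (A x) x = 0) →
      (∀ t < 0, ∀ x, fderiv ℝ (u t) x (a + A x) - A (u t x) = 0) → ∀ t < 0, ∀ x, u t x = 0

/-- (3d) AXIS MODE COUNT — the proposed linear ENGINE for (3b): around a decaying element, any three
classical solutions of the linearised system lying in the CRITICAL WEIGHTED class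
`‖w(t,x)‖ ≤ K/(‖x‖ + √(-t))` (the class of the rotational Jacobi fields `(Ax)·∇u − Au` themselves)
are linearly dependent. Applied to the three rotational Jacobi fields about the decay centre it
gives (3b) with `a = 0` at once (`Σ cᵢ [Aᵢx, u] = [Ax, u]`, `A = Σ cᵢ Aᵢ ≠ 0`). Around `u = 0` the
class is `{0}` (ancient caloric–Stokes fields bounded in weak-`L³` vanish). -/
def AxisModeCount : Prop :=
  ∀ (C : ℝ) (u : ℝ → E3 → E3), InClass C u → HasTypeIDecay C u →
    ∀ (w : Fin 3 → ℝ → E3 → E3) (q : Fin 3 → ℝ → E3 → ℝ),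
      (∀ i, ContDiffOn ℝ (⊤ : ℕ∞) (Function.uncurry (w i)) (Set.Iio 0 ×ˢ Set.univ) ∧
        ContDiffOn ℝ (⊤ : ℕ∞) (Function.uncurry (q i)) (Set.Iio 0 ×ˢ Set.univ) ∧
        (∃ K : ℝ, ∀ t < 0, ∀ x, ‖w i t x‖ ≤ K / (‖x‖ + Real.sqrt (-t))) ∧
        (∀ t < 0, VectorCalculus.IsDivFree (w i t)) ∧
        (∀ t < 0, ∀ x, timeDeriv (w i) t x + convect (u t) (w i t) x + convect (w i t) (u t) x =
          Laplacian.laplacian (w i t) x - gradient (q i t) x)) →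
      ∃ c : Fin 3 → ℝ, c ≠ 0 ∧ ∀ t < 0, ∀ x, ∑ i, c i • w i t x = 0

/-- Shape of the Card-3 line: the three stubs decide the crux BY NAME (pure logic). -/
theorem crux_of_axis_pinning (hB : Bridge) (hA : ForcedAxisymmetryDecaying) (hK : KnownAxisLeaf) :
    Summit.NavierStokesRegularity.NavierStokesRegularity.Theses.SymmetryModuliCount.ForcedSymmetry := by
  intro C u hu
  -- `hu` is literally `InClass C u`.
  have hu' : InClass C u := hu
  by_cases hz : ∀ t < 0, ∀ x, u t x = 0
  · -- `u ≡ 0` has every symmetry; take the translation `ξ = (e₀, 0, 0)`.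
    refine ⟨EuclideanSpace.single 0 1, 0, 0, ?_, ?_, ?_⟩
    · intro x; simp
    · rintro ⟨h0, -, -⟩
      have := congrArg (fun v : E3 => v 0) h0
      simp at this
    · intro t ht x
      have hux : u t = fun _ => 0 := funext (hz t ht)
      simp [hux]
  · exfalso
    obtain ⟨C', v, hv, hdec, hnz⟩ := hB ⟨C, u, hu', hz⟩
    rcases hA C' v hv hdec with hzero | ⟨a, A, hA0, hskew, hsym⟩
    · exact hnz hzero
    · exact hnz (hK C' v hv hdec a A hA0 hskew hsym)

end Summit.NavierStokesRegularity.NavierStokesRegularity.Cruxes.ForcedSymmetry.Ideator3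

end
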